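import Literature.Computability.Complexity.CodeFPModArith
import Literature.Computability.Complexity.PCPCoins
import Literature.Computability.Complexity.CodeFPFinite
import Mathlib.NumberTheory.Bertrand
import HarnessLib

/-!
# Typed polynomial time on codes, IV: choosing the prime field and reading the random tape

Trunk `CplxCore`, sequel of `CodeFPModArith.lean`. A verifier over `𝔽_p` with `p = poly(n)` must (i)
FIND its prime deterministically — the least prime above a unary bound, which Bertrand's postulate
(Mathlib's `Nat.exists_prime_lt_and_le_two_mul`) keeps within a factor two —, (ii) walk through the
points of a cube `Hᵐ` / `Fᵐ` by their INDEX, i.e. compute base-`b` digits, and (iii) turn its COINS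
into uniform field elements, the parse whose counting is `PCPCoins.lean` (blocks of `b` coins read as
little-endian numbers, failure if one reaches the cap `p ⌊2^b/p⌋`, otherwise residues). This file
types the three as `CodeFP` programs with their specifications:

* `isPrimeB k` (trial division, `isPrimeB_eq : isPrimeB k = decide k.Prime`) and `CodeFP.isPrimeUn`
  (on a unary `k`); `leastPrimeGt N` (the least prime `> N`: prime, `> N`, `≤ 2N + 2`, minimal) and
  **`CodeFP.leastPrimeGtCode : CodeFP unE natE leastPrimeGt`**, `CodeFP.leastPrimeGtUn` (unary output);
* `digitsLE b m n = [n / bⁱ mod b | i < m]` (little-endian digits, `sum_digitsLE_mul_pow`: `∑ dᵢ bⁱ = n` below `bᵐ`) and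
  **`CodeFP.digitsCode`** on `((b, 1ᵐ), n)`; `CodeFP.natListSum`;
* `coinParse b p L ρ = (Good, residues)` with `coinParse_fst` (an `iff`)/`coinParse_snd`/`coinParse_snd_getD`
  identifying it with `PCPCoins.Good p b L ρ` and `PCPCoins.dec p b L ρ`, and **`CodeFP.coinParseCode`**
  on `((1ᴸ, 1ᵇ), (ρ, p))`.

Everything is proved; no machine or growth estimate is written (one fold: the prime search, whose
accumulator is an index below the budget).

## References

* S. Arora, B. Barak, *Computational Complexity: A Modern Approach*, CUP 2009, §1.3 (bounded loops),
  §7.1 (coins versus other random choices), §A.4 (`GF(p)`) [AroraBarakCC2009].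
* P. L. Chebyshev (1852) / P. Erdős (1932), Bertrand's postulate; Mathlib `Nat.exists_prime_lt_and_le_two_mul`.
-/

namespace Literature.Computability.Complexity

open _root_.Computability Polynomial Finset

/-! ### Primality by trial division; the least prime above a bound -/

/-- Trial division: `k ≥ 2` and no `d` with `2 ≤ d < k` divides `k`. [folklore] -/
def isPrimeB (k : ℕ) : Bool :=
  decide (2 ≤ k) && (List.range k).all fun d => decide (d < 2) || !decide (k % d = 0)

/-- **Trial division decides primality.** [folklore] -/
theorem isPrimeB_eq (k : ℕ) : isPrimeB k = decide k.Prime := by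
  rw [isPrimeB]
  by_cases hk : k.Prime
  · rw [decide_eq_true hk, decide_eq_true hk.two_le, Bool.true_and, List.all_eq_true]
    intro d hd
    rw [List.mem_range] at hd
    by_cases hd2 : d < 2
    · simp [hd2]
    · have : ¬ d ∣ k := (Nat.prime_def_lt'.1 hk).2 d (by omega) hd
      simp [hd2, Nat.dvd_iff_mod_eq_zero.not.1 this]
  · rw [decide_eq_false hk]
    by_cases h2 : 2 ≤ k
    · rw [decide_eq_true h2, Bool.true_and, List.all_eq_false]
      have : ¬ ∀ m, 2 ≤ m → m < k → ¬ m ∣ k := fun h => hk (Nat.prime_def_lt'.2 ⟨h2, h⟩)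
      push Not at this
      obtain ⟨m, hm2, hmk, hdvd⟩ := this
      exact ⟨m, List.mem_range.2 hmk, by simp [show ¬ m < 2 by omega, Nat.dvd_iff_mod_eq_zero.1 hdvd]⟩
    · rw [decide_eq_false h2, Bool.false_and]

/-- There is a prime above every bound, at most `2N + 2` (Bertrand's postulate, Mathlib's
`Nat.exists_prime_lt_and_le_two_mul`). [folklore] -/
theorem exists_prime_gt_le (N : ℕ) : ∃ p, p.Prime ∧ N < p ∧ p ≤ 2 * N + 2 := by
  rcases Nat.eq_zero_or_pos N with rfl | hN
  · exact ⟨2, Nat.prime_two, by norm_num, by norm_num⟩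
  · obtain ⟨p, hp, hNp, hp2⟩ := Nat.exists_prime_lt_and_le_two_mul N hN.ne'
    exact ⟨p, hp, hNp, by omega⟩

/-- **The least prime above `N`.** [folklore] -/
noncomputable def leastPrimeGt (N : ℕ) : ℕ := Nat.find (⟨_, (exists_prime_gt_le N).choose_spec.1,
  (exists_prime_gt_le N).choose_spec.2.1⟩ : ∃ p, p.Prime ∧ N < p)

/-- The least prime above `N` is a prime above `N`. [folklore] -/
theorem leastPrimeGt_spec (N : ℕ) : (leastPrimeGt N).Prime ∧ N < leastPrimeGt N :=
  Nat.find_spec (⟨_, (exists_prime_gt_le N).choose_spec.1, (exists_prime_gt_le N).choose_spec.2.1⟩ : ∃ p, p.Prime ∧ N < p)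

/-- Minimality. [folklore] -/
theorem leastPrimeGt_min {N q : ℕ} (hq : q.Prime) (hNq : N < q) : leastPrimeGt N ≤ q :=
  Nat.find_min' _ ⟨hq, hNq⟩

/-- **Bertrand**: `leastPrimeGt N ≤ 2N + 2` (Mathlib's `Nat.exists_prime_lt_and_le_two_mul`). [folklore] -/
theorem leastPrimeGt_le (N : ℕ) : leastPrimeGt N ≤ 2 * N + 2 := by
  obtain ⟨p, hp, hNp, hp2⟩ := exists_prime_gt_le N
  exact (leastPrimeGt_min hp hNp).trans hp2

/-- **The search**: the first index of `[0, n)` above `N` that is prime is the least prime above `N`,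
once the budget `n` exceeds it. [folklore] -/
theorem find?_range_prime {N n : ℕ} (hn : leastPrimeGt N < n) :
    (List.range n).find? (fun i => decide (N < i) && isPrimeB i) = some (leastPrimeGt N) := by
  rw [List.find?_range_eq_some]
  refine ⟨?_, List.mem_range.2 hn, fun j hj => ?_⟩
  · simp [isPrimeB_eq, (leastPrimeGt_spec N).1, (leastPrimeGt_spec N).2]
  · simp only [isPrimeB_eq, Bool.not_eq_true', Bool.and_eq_false_imp, decide_eq_true_eq]
    exact fun hNj => decide_eq_false fun hpj => absurd (leastPrimeGt_min hpj hNj) (not_le.2 hj)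

namespace CodeFP

open ModArith Brick

variable {α : Type} {eα : α → List Bool}

/-- **Trial division on a unary numeral.** [cite: AroraBarakCC2009, §1.3 (bounded loops)] -/
theorem isPrimeUn : CodeFP unE bitE isPrimeB := by
  -- context `k` (binary), item `d`
  have hk : CodeFP (pairE natE natE) natE (fun t => t.1) := fst _ _
  have hd : CodeFP (pairE natE natE) natE (fun t => t.2) := snd _ _
  have hp : CodeFP (pairE natE natE) bitE (fun t => decide (t.2 < 2) || !decide (t.1 % t.2 = 0)) :=
    (natLt.comp (hd.pair (const _ 2))).or (natEq.comp ((natMod.comp (hk.pair hd)).pair (const _ 0))).not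
  refine ((natLe.comp ((const unE 2).pair natOfUn)).and
    ((all hp).comp (natOfUn.pair urange))).congr fun k => ?_
  rfl

/-- **The least prime above a unary bound**, in binary (trial division over the budget `[0, 2N + 3)`, which
Bertrand's postulate makes sufficient; `CodeFP.rawFind?`). [cite: AroraBarakCC2009, §1.3 (bounded loops)] -/
theorem leastPrimeGtCode : CodeFP unE natE leastPrimeGt := by
  -- context `(N, 1^{2N+3})`, item `i`
  have hN : CodeFP (pairE (pairE natE unE) natE) natE (fun t => t.1.1) := (fst _ _).fst'
  have hB : CodeFP (pairE (pairE natE unE) natE) unE (fun t => t.1.2) := (fst _ _).snd'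
  have hi : CodeFP (pairE (pairE natE unE) natE) natE (fun t => t.2) := snd _ _
  have hp : CodeFP (pairE (pairE natE unE) natE) bitE (fun t => decide (t.1.1 < t.2) && isPrimeB (min t.2 t.1.2)) :=
    (natLt.comp (hN.pair hi)).and (isPrimeUn.comp (unOfNatMin.comp (hB.pair hi)))
  have hbudget : CodeFP unE unE (fun N => 2 * N + 3) :=
    (unSucc.comp (unSucc.comp (unSucc.comp (unAdd.comp ((CodeFP.id unE).pair (CodeFP.id unE)))))).congr fun N => by
      simp only [id]; omega
  have hval : CodeFP (optE natE) natE (fun o => o.toList.headD 0) := (rawHeadD natE rfl).comp (optToList natE)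
  refine ((hval.comp ((rawFind? hp).comp ((natOfUn.pair hbudget).pair (urange.comp hbudget)))).congr fun N => ?_)
  have hlp := leastPrimeGt_le N
  change ((List.range (2 * N + 3)).find? fun i => decide (N < i) && isPrimeB (min i (2 * N + 3))).toList.headD 0 = _
  have hfind : ((List.range (2 * N + 3)).find? fun i => decide (N < i) && isPrimeB (min i (2 * N + 3))) =
      some (leastPrimeGt N) := by
    obtain ⟨h1, h2, h3⟩ := List.find?_range_eq_some.1 (find?_range_prime (N := N) (n := 2 * N + 3) (by omega))
    rw [List.find?_range_eq_some]
    refine ⟨by rwa [min_eq_left (by omega : leastPrimeGt N ≤ 2 * N + 3)], h2, fun j hj => ?_⟩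
    rw [min_eq_left (by omega : j ≤ 2 * N + 3)]
    exact h3 j hj
  rw [hfind]
  rfl

/-- The least prime above a unary bound, in unary (capped by the budget it lies within). [folklore] -/
theorem leastPrimeGtUn : CodeFP unE unE leastPrimeGt :=
  (unOfNatMin.comp (((unSucc.comp (unSucc.comp (unAdd.comp ((CodeFP.id unE).pair (CodeFP.id unE)))))).pair
    leastPrimeGtCode)).congr fun N => by
      have := leastPrimeGt_le N
      simp only [id]
      omega

end CodeFP

/-! ### Digits: walking a cube by index -/

/-- The `m` little-endian base-`b` digits of `n`: `[n / bⁱ mod b | i < m]`. [folklore] -/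
def digitsLE (b m n : ℕ) : List ℕ := (List.range m).map fun i => n / b ^ i % b

/-- The number of digits. [folklore] -/
@[simp] theorem length_digitsLE (b m n : ℕ) : (digitsLE b m n).length = m := by simp [digitsLE]

/-- Each digit is below the base (`b > 0`). [folklore] -/
theorem digitsLE_lt {b : ℕ} (hb : 0 < b) (m n : ℕ) : ∀ d ∈ digitsLE b m n, d < b := by
  intro d hd
  obtain ⟨i, -, rfl⟩ := List.mem_map.1 hd
  exact Nat.mod_lt _ hb

/-- The `i`-th digit. [folklore] -/
theorem getD_digitsLE {b m n i : ℕ} (hi : i < m) : (digitsLE b m n).getD i 0 = n / b ^ i % b := by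
  rw [digitsLE, List.getD_eq_getElem _ _ (by simpa using hi)]
  simp

/-- **The digits determine the number below `bᵐ`**: `∑ᵢ dᵢ bⁱ = n`. [folklore] -/
theorem sum_digitsLE_mul_pow {b m n : ℕ} (hn : n < b ^ m) :
    ∑ i ∈ range m, (n / b ^ i % b) * b ^ i = n := by
  induction m generalizing n with
  | zero => simp at hn ⊢; omega
  | succ m ih =>
    rw [sum_range_succ', pow_zero, Nat.div_one, mul_one]
    have h1 : ∀ i ∈ range m, n / b ^ (i + 1) % b * b ^ (i + 1) = b * ((n / b) / b ^ i % b * b ^ i) := by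
      intro i _
      rw [pow_succ', ← Nat.div_div_eq_div_mul]
      ring
    have hn' : n / b < b ^ m := Nat.div_lt_of_lt_mul (by rw [pow_succ'] at hn; exact hn)
    rw [sum_congr rfl h1, ← mul_sum, ih hn']
    exact Nat.div_add_mod n b

namespace CodeFP

open ModArith

/-- **The sum of a raw list of numerals** (the fold `sumMod` at modulus `0`). [folklore] -/
theorem natListSum : CodeFP (rawE natE) natE List.sum :=
  (sumMod.comp ((const _ 0).pair (CodeFP.id _))).congr fun l => by simp [sumM_eq]

/-- **Digits by index**: `((b, 1ᵐ), n) ↦ digitsLE b m n`. [cite: AroraBarakCC2009, §1.3] -/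
theorem digitsCode : CodeFP (pairE (pairE natE unE) natE) (rawE natE) (fun t => digitsLE t.1.1 t.1.2 t.2) := by
  -- context `((b, 1ᵐ), n)`, item `i` (binary; the power takes it in unary, capped by `m`)
  have hb : CodeFP (pairE (pairE (pairE natE unE) natE) natE) natE (fun t => t.1.1.1) := (fst _ _).fst'.fst'
  have hm : CodeFP (pairE (pairE (pairE natE unE) natE) natE) unE (fun t => t.1.1.2) := (fst _ _).fst'.snd'
  have hn : CodeFP (pairE (pairE (pairE natE unE) natE) natE) natE (fun t => t.1.2) := (fst _ _).snd'
  have hi : CodeFP (pairE (pairE (pairE natE unE) natE) natE) unE (fun t => min t.2 t.1.1.2) :=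
    unOfNatMin.comp (hm.pair (snd _ _))
  have hg : CodeFP (pairE (pairE (pairE natE unE) natE) natE) natE (fun t => t.1.2 / t.1.1.1 ^ min t.2 t.1.1.2 % t.1.1.1) :=
    natMod.comp ((natDiv.comp (hn.pair (natPow.comp (hb.pair hi)))).pair hb)
  refine ((map hg).comp ((CodeFP.id _).pair (urange.comp (fst _ _).snd'))).congr fun t => ?_
  simp only [digitsLE, id]
  refine List.map_congr_left fun i hi => ?_
  rw [min_eq_left (List.mem_range.1 hi).le]

end CodeFP

/-! ### Reading the random tape: coin blocks to residues -/

/-- **The parse of `L` blocks of `b` coins modulo `p`**: the success flag (no block value reaches the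
cap `p ⌊2^b/p⌋`) and the residues. [cite: AroraBarakCC2009, §7.1] -/
def coinParse (b p L : ℕ) (ρ : List Bool) : Bool × List ℕ :=
  let vals := (List.range L).map fun j => bitsToNat ((ρ.drop (j * b)).take b)
  (vals.all fun v => decide (v < p * (2 ^ b / p)), vals.map fun v => v % p)

/-- The flag is `PCPCoins.Good`. [folklore] -/
theorem coinParse_fst (b p L : ℕ) (ρ : List Bool) : (coinParse b p L ρ).1 = true ↔ PCPCoins.Good p b L ρ := by
  rw [PCPCoins.good_iff]
  simp only [coinParse, List.all_eq_true, List.mem_map, List.mem_range, forall_exists_index, and_imp,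
    decide_eq_true_eq]
  exact ⟨fun h j hj => h _ j hj rfl, fun h v j hj hv => hv ▸ h j hj⟩

/-- The residues are the block values reduced. [folklore] -/
theorem coinParse_snd (b p L : ℕ) (ρ : List Bool) :
    (coinParse b p L ρ).2 = (List.range L).map fun j => bitsToNat ((ρ.drop (j * b)).take b) % p := by
  simp [coinParse]

/-- The residues as field elements are `PCPCoins.dec`. [folklore] -/
theorem coinParse_snd_getD (b p L : ℕ) (ρ : List Bool) {j : ℕ} (hj : j < L) :
    (((coinParse b p L ρ).2.getD j 0 : ℕ) : ZMod p) = PCPCoins.dec p b L ρ ⟨j, hj⟩ := by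
  rw [coinParse_snd, List.getD_eq_getElem _ _ (by simpa using hj), PCPCoins.dec_apply]
  simp [ZMod.natCast_mod]

namespace CodeFP

/-- **The parse as a program** on `((1ᴸ, 1ᵇ), (ρ, p))`. [cite: AroraBarakCC2009, §7.1 with §1.3] -/
theorem coinParseCode : CodeFP (pairE (pairE unE unE) (pairE strE natE)) (pairE bitE (rawE natE))
    (fun t => coinParse t.1.2 t.2.2 t.1.1 t.2.1) := by
  -- the block values
  have hvals : CodeFP (pairE (pairE unE unE) (pairE strE natE)) (rawE natE)
      (fun t => (List.range t.1.1).map fun j => bitsToNat ((t.2.1.drop (j * t.1.2)).take t.1.2)) :=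
    ((map₀ strVal).comp (strChunks.comp ((fst _ _).fst'.pair ((fst _ _).snd'.pair (snd _ _).fst')))).congr
      fun t => by simp [List.map_map, Function.comp_def]
  -- the cap `p ⌊2^b/p⌋`
  have hcap : CodeFP (pairE (pairE unE unE) (pairE strE natE)) natE (fun t => t.2.2 * (2 ^ t.1.2 / t.2.2)) :=
    natMul.comp ((snd _ _).snd'.pair (natDiv.comp ((natPow.comp ((const _ 2).pair (fst _ _).snd')).pair (snd _ _).snd')))
  have hgood : CodeFP (pairE natE natE) bitE (fun t => decide (t.2 < t.1)) := natLt.comp ((snd _ _).pair (fst _ _))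
  have hres : CodeFP (pairE natE natE) natE (fun t => t.2 % t.1) := natMod.comp ((snd _ _).pair (fst _ _))
  refine (((all hgood).comp (hcap.pair hvals)).pair ((map hres).comp ((snd _ _).snd'.pair hvals))).congr fun t => ?_
  rfl

end CodeFP

end Literature.Computability.Complexity
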